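import Summits.HodgeConjecture.HodgeConjecture.Theorems.EightfoldBlochSeedsChernCharacterOnBettiAnalytificationShortExact
import Literature.AlgebraicTopology.CharacteristicClasses.ShortExactSequenceSplitting
import Literature.AlgebraicGeometry.Modules.VectorBundleFiniteLocallyFree
import HarnessLib

/-!
# K1 (analytification bridge), K1f completed: the Chern character of analytifications is ADDITIVE on
# short exact sequences of algebraic vector bundles (`ch_shortExact`)

Route `EightfoldBlochSeeds` / item `stmt-HodgeConjecture-19780` (`ChernCharacterOnBetti`), helper
(`--supports`). HONEST FRAMING: nothing here proves 19780 / 18880 / 18882 / 18883 / H2 / HC_AV / HC;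
no definition, no named fact.

WHAT. For a short exact sequence `S : 0 → F₁ → F₂ → F₃ → 0` of `𝒪_X`-modules on a smooth projective
complex variety `X` with `F₁`, `F₃` vector bundles, and topological analytification data
`(Eᵢ, αᵢ)` of the three modules (steps K1a–K1d: complex vector bundles `Eᵢ` on `X(ℂ)` with Serre's
comparison maps, frames of sizes `rᵢ` near every point), the topological Chern characters satisfy

  `ch_k(E₂) = ch_k(E₁) + ch_k(E₃)` in `complexBetti X (2 * k) = H²ᵏ(X(ℂ); ℂ)`

(`topologicalChernCharacter_eq_add_of_comparison_shortExact`), and the Chern classes the Whitney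
formula `c_m(E₂) = Σ_{i+j=m} cᵢ(E₁) ⌣ cⱼ(E₃)` (`chernClass_eq_sum_of_comparison_shortExact`). This is
the field `ch_shortExact` of `HodgeTheory.ChernCharacterBetti` for the candidate
`ch X F k := theChernClassTheory.topologicalChernCharacter ℂ F(ℂ) k` on smooth projective `X`
(Fulton, *Intersection Theory*, Ex. 3.2.3: "For any exact sequence of vector bundles …
`ch(E) = ch(E') + ch(E'')`"). Proof: the analytified maps `u = f^an`, `v = g^an` are continuous and
fibrewise short exact (`exists_bundleMaps_shortExact_of_comparison`, Serre GAGA §3 Prop. 10), so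
`E₂ ≅ E₁ ⊕ E₃` as topological bundles over the paracompact Hausdorff `X(ℂ)` (Husemoller Ch. 3
Thm. 9.6, `ComplexVectorBundle.nonempty_iso_directSum_of_shortExact`) and the Chern character is
additive under Whitney sum (Hirzebruch §10.1, `ChernClassTheory.topologicalChernCharacter_shortExact`).
The version `…_of_isVectorBundle` takes the field's hypotheses `IsVectorBundle F₁`, `IsVectorBundle F₃`
(Mathlib's locally free of finite type).

[cite: Fulton1998, Example 3.2.3] [cite: SerreGAGA1956, §3 n°9 Prop. 10]
[cite: HusemollerFibreBundles1994, Ch. 3 §9 Thm. 9.6] [cite: Hirzebruch1966, §10.1]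
-/

noncomputable section

-- single-problem summit (Problem = Summit): the mandated namespace repeats `HodgeConjecture`.
set_option linter.dupNamespace false

open CategoryTheory AlgebraicGeometry Bundle Topology
open Literature.AlgebraicGeometry.Motives Literature.AlgebraicGeometry.HodgeTheory Literature.AlgebraicGeometry.Modules
open Literature.AlgebraicTopology.SingularHomology Literature.AlgebraicTopology.CharacteristicClasses

namespace Summit.HodgeConjecture.HodgeConjecture.Theorems

variable {n : ℕ} {X : SchemeOver ℂ} {S : ShortComplex X.left.Modules} {r₁ r₂ r₃ : ℕ}

/-- **`ch_k(F₂(ℂ)) = ch_k(F₁(ℂ)) + ch_k(F₃(ℂ))` — additivity of the Chern character of analytifications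
on short exact sequences.** For `S : 0 → F₁ → F₂ → F₃ → 0` short exact on a smooth projective complex
`X` with `F₁`, `F₃` finite locally free and analytification data `(Eᵢ, αᵢ)` of the three modules, the
topological Chern characters in `complexBetti X (2 * k)` are additive.
[cite: Fulton1998, Example 3.2.3] [cite: SerreGAGA1956, §3 n°9 Prop. 10]
[cite: HusemollerFibreBundles1994, Ch. 3 §9 Thm. 9.6] [cite: Hirzebruch1966, §10.1] -/
theorem topologicalChernCharacter_eq_add_of_comparison_shortExact (hX : IsSmoothProjective n X)
    (hS : S.ShortExact) (h₁ : IsFiniteLocallyFree S.X₁) (h₃ : IsFiniteLocallyFree S.X₃)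
    (hF₁ : ∀ x : X.left, ∃ (U : X.left.Opens) (s : Fin r₁ → Γ(S.X₁, U)), x ∈ U ∧ IsSectionFrame S.X₁ U s)
    (hF₂ : ∀ x : X.left, ∃ (U : X.left.Opens) (s : Fin r₂ → Γ(S.X₂, U)), x ∈ U ∧ IsSectionFrame S.X₂ U s)
    (hF₃ : ∀ x : X.left, ∃ (U : X.left.Opens) (s : Fin r₃ → Γ(S.X₃, U)), x ∈ U ∧ IsSectionFrame S.X₃ U s)
    (E₁ E₂ E₃ : ComplexVectorBundle.{0, 0} (ComplexPoints X))
    (α₁ : ∀ U : X.left.Opens, Γ(S.X₁, U) → ∀ P : ComplexPoints X, E₁.E P)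
    (α₂ : ∀ U : X.left.Opens, Γ(S.X₂, U) → ∀ P : ComplexPoints X, E₂.E P)
    (α₃ : ∀ U : X.left.Opens, Γ(S.X₃, U) → ∀ P : ComplexPoints X, E₃.E P)
    (hadd₁ : ∀ (U : X.left.Opens) (σ τ : Γ(S.X₁, U)) (P : ComplexPoints X), α₁ U (σ + τ) P = α₁ U σ P + α₁ U τ P)
    (hsmul₁ : ∀ (U : X.left.Opens) (f : Γ(X.left, U)) (σ : Γ(S.X₁, U)) (P : ComplexPoints X) (h : P.pt ∈ U),
      α₁ U (f • σ) P = P.eval U h f • α₁ U σ P)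
    (hres₁ : ∀ (U W : X.left.Opens) (hWU : W ≤ U) (σ : Γ(S.X₁, U)) (P : ComplexPoints X), P.pt ∈ W →
      α₁ W (S.X₁.presheaf.map (homOfLE hWU).op σ) P = α₁ U σ P)
    (hcont₁ : ∀ (U : X.left.Opens) (σ : Γ(S.X₁, U)),
      ContinuousOn (fun P ↦ (⟨P, α₁ U σ P⟩ : TotalSpace E₁.F E₁.E)) {P | P.pt ∈ U})
    (hframe₁ : ∀ (U : X.left.Opens) (t : Fin r₁ → Γ(S.X₁, U)), IsSectionFrame S.X₁ U t →
      ∀ P : ComplexPoints X, P.pt ∈ U → LinearIndependent ℂ (fun j ↦ α₁ U (t j) P) ∧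
        ⊤ ≤ Submodule.span ℂ (Set.range fun j ↦ α₁ U (t j) P))
    (hadd₂ : ∀ (U : X.left.Opens) (σ τ : Γ(S.X₂, U)) (P : ComplexPoints X), α₂ U (σ + τ) P = α₂ U σ P + α₂ U τ P)
    (hsmul₂ : ∀ (U : X.left.Opens) (f : Γ(X.left, U)) (σ : Γ(S.X₂, U)) (P : ComplexPoints X) (h : P.pt ∈ U),
      α₂ U (f • σ) P = P.eval U h f • α₂ U σ P)
    (hres₂ : ∀ (U W : X.left.Opens) (hWU : W ≤ U) (σ : Γ(S.X₂, U)) (P : ComplexPoints X), P.pt ∈ W →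
      α₂ W (S.X₂.presheaf.map (homOfLE hWU).op σ) P = α₂ U σ P)
    (hcont₂ : ∀ (U : X.left.Opens) (σ : Γ(S.X₂, U)),
      ContinuousOn (fun P ↦ (⟨P, α₂ U σ P⟩ : TotalSpace E₂.F E₂.E)) {P | P.pt ∈ U})
    (hframe₂ : ∀ (U : X.left.Opens) (t : Fin r₂ → Γ(S.X₂, U)), IsSectionFrame S.X₂ U t →
      ∀ P : ComplexPoints X, P.pt ∈ U → LinearIndependent ℂ (fun j ↦ α₂ U (t j) P) ∧
        ⊤ ≤ Submodule.span ℂ (Set.range fun j ↦ α₂ U (t j) P))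
    (hadd₃ : ∀ (U : X.left.Opens) (σ τ : Γ(S.X₃, U)) (P : ComplexPoints X), α₃ U (σ + τ) P = α₃ U σ P + α₃ U τ P)
    (hsmul₃ : ∀ (U : X.left.Opens) (f : Γ(X.left, U)) (σ : Γ(S.X₃, U)) (P : ComplexPoints X) (h : P.pt ∈ U),
      α₃ U (f • σ) P = P.eval U h f • α₃ U σ P)
    (hres₃ : ∀ (U W : X.left.Opens) (hWU : W ≤ U) (σ : Γ(S.X₃, U)) (P : ComplexPoints X), P.pt ∈ W →
      α₃ W (S.X₃.presheaf.map (homOfLE hWU).op σ) P = α₃ U σ P)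
    (hcont₃ : ∀ (U : X.left.Opens) (σ : Γ(S.X₃, U)),
      ContinuousOn (fun P ↦ (⟨P, α₃ U σ P⟩ : TotalSpace E₃.F E₃.E)) {P | P.pt ∈ U})
    (hframe₃ : ∀ (U : X.left.Opens) (t : Fin r₃ → Γ(S.X₃, U)), IsSectionFrame S.X₃ U t →
      ∀ P : ComplexPoints X, P.pt ∈ U → LinearIndependent ℂ (fun j ↦ α₃ U (t j) P) ∧
        ⊤ ≤ Submodule.span ℂ (Set.range fun j ↦ α₃ U (t j) P)) (k : ℕ) :
    theChernClassTheory.topologicalChernCharacter ℂ E₂ k =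
      theChernClassTheory.topologicalChernCharacter ℂ E₁ k + theChernClassTheory.topologicalChernCharacter ℂ E₃ k := by
  haveI := ComplexPoints.t2Space_of_isSmoothProjective hX
  haveI := paracompactSpace_complexPoints_of_isSmoothProjective hX
  obtain ⟨u, v, -, -, hcu, hcv, hex⟩ := exists_bundleMaps_shortExact_of_comparison hS h₁ h₃ hF₁ hF₂ hF₃ E₁ E₂ E₃
    α₁ α₂ α₃ hadd₁ hsmul₁ hres₁ hcont₁ hframe₁ hadd₂ hsmul₂ hres₂ hcont₂ hframe₂ hadd₃ hsmul₃ hres₃ hcont₃ hframe₃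
  exact theChernClassTheory.topologicalChernCharacter_shortExact u v hcu hcv hex ℂ k

/-- **Whitney for short exact sequences of algebraic vector bundles, analytified**:
`c_m(F₂(ℂ)) = Σ_{i+j=m} cᵢ(F₁(ℂ)) ⌣ cⱼ(F₃(ℂ))` (integral classes; same hypotheses).
[cite: HusemollerFibreBundles1994, Ch. 3 §9 Thm. 9.6 and Ch. 17 §3 (C₂)] [cite: SerreGAGA1956, §3 n°9 Prop. 10] -/
theorem chernClass_eq_sum_of_comparison_shortExact (hX : IsSmoothProjective n X)
    (hS : S.ShortExact) (h₁ : IsFiniteLocallyFree S.X₁) (h₃ : IsFiniteLocallyFree S.X₃)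
    (hF₁ : ∀ x : X.left, ∃ (U : X.left.Opens) (s : Fin r₁ → Γ(S.X₁, U)), x ∈ U ∧ IsSectionFrame S.X₁ U s)
    (hF₂ : ∀ x : X.left, ∃ (U : X.left.Opens) (s : Fin r₂ → Γ(S.X₂, U)), x ∈ U ∧ IsSectionFrame S.X₂ U s)
    (hF₃ : ∀ x : X.left, ∃ (U : X.left.Opens) (s : Fin r₃ → Γ(S.X₃, U)), x ∈ U ∧ IsSectionFrame S.X₃ U s)
    (E₁ E₂ E₃ : ComplexVectorBundle.{0, 0} (ComplexPoints X))
    (α₁ : ∀ U : X.left.Opens, Γ(S.X₁, U) → ∀ P : ComplexPoints X, E₁.E P)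
    (α₂ : ∀ U : X.left.Opens, Γ(S.X₂, U) → ∀ P : ComplexPoints X, E₂.E P)
    (α₃ : ∀ U : X.left.Opens, Γ(S.X₃, U) → ∀ P : ComplexPoints X, E₃.E P)
    (hadd₁ : ∀ (U : X.left.Opens) (σ τ : Γ(S.X₁, U)) (P : ComplexPoints X), α₁ U (σ + τ) P = α₁ U σ P + α₁ U τ P)
    (hsmul₁ : ∀ (U : X.left.Opens) (f : Γ(X.left, U)) (σ : Γ(S.X₁, U)) (P : ComplexPoints X) (h : P.pt ∈ U),
      α₁ U (f • σ) P = P.eval U h f • α₁ U σ P)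
    (hres₁ : ∀ (U W : X.left.Opens) (hWU : W ≤ U) (σ : Γ(S.X₁, U)) (P : ComplexPoints X), P.pt ∈ W →
      α₁ W (S.X₁.presheaf.map (homOfLE hWU).op σ) P = α₁ U σ P)
    (hcont₁ : ∀ (U : X.left.Opens) (σ : Γ(S.X₁, U)),
      ContinuousOn (fun P ↦ (⟨P, α₁ U σ P⟩ : TotalSpace E₁.F E₁.E)) {P | P.pt ∈ U})
    (hframe₁ : ∀ (U : X.left.Opens) (t : Fin r₁ → Γ(S.X₁, U)), IsSectionFrame S.X₁ U t →
      ∀ P : ComplexPoints X, P.pt ∈ U → LinearIndependent ℂ (fun j ↦ α₁ U (t j) P) ∧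
        ⊤ ≤ Submodule.span ℂ (Set.range fun j ↦ α₁ U (t j) P))
    (hadd₂ : ∀ (U : X.left.Opens) (σ τ : Γ(S.X₂, U)) (P : ComplexPoints X), α₂ U (σ + τ) P = α₂ U σ P + α₂ U τ P)
    (hsmul₂ : ∀ (U : X.left.Opens) (f : Γ(X.left, U)) (σ : Γ(S.X₂, U)) (P : ComplexPoints X) (h : P.pt ∈ U),
      α₂ U (f • σ) P = P.eval U h f • α₂ U σ P)
    (hres₂ : ∀ (U W : X.left.Opens) (hWU : W ≤ U) (σ : Γ(S.X₂, U)) (P : ComplexPoints X), P.pt ∈ W →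
      α₂ W (S.X₂.presheaf.map (homOfLE hWU).op σ) P = α₂ U σ P)
    (hcont₂ : ∀ (U : X.left.Opens) (σ : Γ(S.X₂, U)),
      ContinuousOn (fun P ↦ (⟨P, α₂ U σ P⟩ : TotalSpace E₂.F E₂.E)) {P | P.pt ∈ U})
    (hframe₂ : ∀ (U : X.left.Opens) (t : Fin r₂ → Γ(S.X₂, U)), IsSectionFrame S.X₂ U t →
      ∀ P : ComplexPoints X, P.pt ∈ U → LinearIndependent ℂ (fun j ↦ α₂ U (t j) P) ∧
        ⊤ ≤ Submodule.span ℂ (Set.range fun j ↦ α₂ U (t j) P))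
    (hadd₃ : ∀ (U : X.left.Opens) (σ τ : Γ(S.X₃, U)) (P : ComplexPoints X), α₃ U (σ + τ) P = α₃ U σ P + α₃ U τ P)
    (hsmul₃ : ∀ (U : X.left.Opens) (f : Γ(X.left, U)) (σ : Γ(S.X₃, U)) (P : ComplexPoints X) (h : P.pt ∈ U),
      α₃ U (f • σ) P = P.eval U h f • α₃ U σ P)
    (hres₃ : ∀ (U W : X.left.Opens) (hWU : W ≤ U) (σ : Γ(S.X₃, U)) (P : ComplexPoints X), P.pt ∈ W →
      α₃ W (S.X₃.presheaf.map (homOfLE hWU).op σ) P = α₃ U σ P)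
    (hcont₃ : ∀ (U : X.left.Opens) (σ : Γ(S.X₃, U)),
      ContinuousOn (fun P ↦ (⟨P, α₃ U σ P⟩ : TotalSpace E₃.F E₃.E)) {P | P.pt ∈ U})
    (hframe₃ : ∀ (U : X.left.Opens) (t : Fin r₃ → Γ(S.X₃, U)), IsSectionFrame S.X₃ U t →
      ∀ P : ComplexPoints X, P.pt ∈ U → LinearIndependent ℂ (fun j ↦ α₃ U (t j) P) ∧
        ⊤ ≤ Submodule.span ℂ (Set.range fun j ↦ α₃ U (t j) P)) (m : ℕ) :
    theChernClassTheory.chernClass E₂ m = ∑ ij : Finset.HasAntidiagonal.antidiagonal m,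
      cupEven (Finset.HasAntidiagonal.mem_antidiagonal.mp ij.2) (theChernClassTheory.chernClass E₁ ij.1.1)
        (theChernClassTheory.chernClass E₃ ij.1.2) := by
  haveI := ComplexPoints.t2Space_of_isSmoothProjective hX
  haveI := paracompactSpace_complexPoints_of_isSmoothProjective hX
  obtain ⟨u, v, -, -, hcu, hcv, hex⟩ := exists_bundleMaps_shortExact_of_comparison hS h₁ h₃ hF₁ hF₂ hF₃ E₁ E₂ E₃
    α₁ α₂ α₃ hadd₁ hsmul₁ hres₁ hcont₁ hframe₁ hadd₂ hsmul₂ hres₂ hcont₂ hframe₂ hadd₃ hsmul₃ hres₃ hcont₃ hframe₃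
  exact theChernClassTheory.chernClass_shortExact u v hcu hcv hex m

/-- **The field `ch_shortExact` for analytification data, with the field's hypotheses** (`F₁`, `F₃`
vector bundles in Mathlib's sense: locally free of finite type; then `F₂` is one too): on a smooth
projective complex `X`, for any analytification data of the three terms of a short exact sequence of
vector bundles, `ch_k(F₂(ℂ)) = ch_k(F₁(ℂ)) + ch_k(F₃(ℂ))`. [cite: Fulton1998, Example 3.2.3]
[cite: SerreGAGA1956, §3 n°9 Prop. 10] [cite: HusemollerFibreBundles1994, Ch. 3 §9 Thm. 9.6] -/
theorem topologicalChernCharacter_eq_add_of_comparison_shortExact_of_isVectorBundle (hX : IsSmoothProjective n X)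
    (hS : S.ShortExact) (h₁ : IsVectorBundle S.X₁) (h₃ : IsVectorBundle S.X₃)
    (hF₁ : ∀ x : X.left, ∃ (U : X.left.Opens) (s : Fin r₁ → Γ(S.X₁, U)), x ∈ U ∧ IsSectionFrame S.X₁ U s)
    (hF₂ : ∀ x : X.left, ∃ (U : X.left.Opens) (s : Fin r₂ → Γ(S.X₂, U)), x ∈ U ∧ IsSectionFrame S.X₂ U s)
    (hF₃ : ∀ x : X.left, ∃ (U : X.left.Opens) (s : Fin r₃ → Γ(S.X₃, U)), x ∈ U ∧ IsSectionFrame S.X₃ U s)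
    (E₁ E₂ E₃ : ComplexVectorBundle.{0, 0} (ComplexPoints X))
    (α₁ : ∀ U : X.left.Opens, Γ(S.X₁, U) → ∀ P : ComplexPoints X, E₁.E P)
    (α₂ : ∀ U : X.left.Opens, Γ(S.X₂, U) → ∀ P : ComplexPoints X, E₂.E P)
    (α₃ : ∀ U : X.left.Opens, Γ(S.X₃, U) → ∀ P : ComplexPoints X, E₃.E P)
    (hadd₁ : ∀ (U : X.left.Opens) (σ τ : Γ(S.X₁, U)) (P : ComplexPoints X), α₁ U (σ + τ) P = α₁ U σ P + α₁ U τ P)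
    (hsmul₁ : ∀ (U : X.left.Opens) (f : Γ(X.left, U)) (σ : Γ(S.X₁, U)) (P : ComplexPoints X) (h : P.pt ∈ U),
      α₁ U (f • σ) P = P.eval U h f • α₁ U σ P)
    (hres₁ : ∀ (U W : X.left.Opens) (hWU : W ≤ U) (σ : Γ(S.X₁, U)) (P : ComplexPoints X), P.pt ∈ W →
      α₁ W (S.X₁.presheaf.map (homOfLE hWU).op σ) P = α₁ U σ P)
    (hcont₁ : ∀ (U : X.left.Opens) (σ : Γ(S.X₁, U)),
      ContinuousOn (fun P ↦ (⟨P, α₁ U σ P⟩ : TotalSpace E₁.F E₁.E)) {P | P.pt ∈ U})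
    (hframe₁ : ∀ (U : X.left.Opens) (t : Fin r₁ → Γ(S.X₁, U)), IsSectionFrame S.X₁ U t →
      ∀ P : ComplexPoints X, P.pt ∈ U → LinearIndependent ℂ (fun j ↦ α₁ U (t j) P) ∧
        ⊤ ≤ Submodule.span ℂ (Set.range fun j ↦ α₁ U (t j) P))
    (hadd₂ : ∀ (U : X.left.Opens) (σ τ : Γ(S.X₂, U)) (P : ComplexPoints X), α₂ U (σ + τ) P = α₂ U σ P + α₂ U τ P)
    (hsmul₂ : ∀ (U : X.left.Opens) (f : Γ(X.left, U)) (σ : Γ(S.X₂, U)) (P : ComplexPoints X) (h : P.pt ∈ U),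
      α₂ U (f • σ) P = P.eval U h f • α₂ U σ P)
    (hres₂ : ∀ (U W : X.left.Opens) (hWU : W ≤ U) (σ : Γ(S.X₂, U)) (P : ComplexPoints X), P.pt ∈ W →
      α₂ W (S.X₂.presheaf.map (homOfLE hWU).op σ) P = α₂ U σ P)
    (hcont₂ : ∀ (U : X.left.Opens) (σ : Γ(S.X₂, U)),
      ContinuousOn (fun P ↦ (⟨P, α₂ U σ P⟩ : TotalSpace E₂.F E₂.E)) {P | P.pt ∈ U})
    (hframe₂ : ∀ (U : X.left.Opens) (t : Fin r₂ → Γ(S.X₂, U)), IsSectionFrame S.X₂ U t →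
      ∀ P : ComplexPoints X, P.pt ∈ U → LinearIndependent ℂ (fun j ↦ α₂ U (t j) P) ∧
        ⊤ ≤ Submodule.span ℂ (Set.range fun j ↦ α₂ U (t j) P))
    (hadd₃ : ∀ (U : X.left.Opens) (σ τ : Γ(S.X₃, U)) (P : ComplexPoints X), α₃ U (σ + τ) P = α₃ U σ P + α₃ U τ P)
    (hsmul₃ : ∀ (U : X.left.Opens) (f : Γ(X.left, U)) (σ : Γ(S.X₃, U)) (P : ComplexPoints X) (h : P.pt ∈ U),
      α₃ U (f • σ) P = P.eval U h f • α₃ U σ P)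
    (hres₃ : ∀ (U W : X.left.Opens) (hWU : W ≤ U) (σ : Γ(S.X₃, U)) (P : ComplexPoints X), P.pt ∈ W →
      α₃ W (S.X₃.presheaf.map (homOfLE hWU).op σ) P = α₃ U σ P)
    (hcont₃ : ∀ (U : X.left.Opens) (σ : Γ(S.X₃, U)),
      ContinuousOn (fun P ↦ (⟨P, α₃ U σ P⟩ : TotalSpace E₃.F E₃.E)) {P | P.pt ∈ U})
    (hframe₃ : ∀ (U : X.left.Opens) (t : Fin r₃ → Γ(S.X₃, U)), IsSectionFrame S.X₃ U t →
      ∀ P : ComplexPoints X, P.pt ∈ U → LinearIndependent ℂ (fun j ↦ α₃ U (t j) P) ∧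
        ⊤ ≤ Submodule.span ℂ (Set.range fun j ↦ α₃ U (t j) P)) (k : ℕ) :
    theChernClassTheory.topologicalChernCharacter ℂ E₂ k =
      theChernClassTheory.topologicalChernCharacter ℂ E₁ k + theChernClassTheory.topologicalChernCharacter ℂ E₃ k :=
  topologicalChernCharacter_eq_add_of_comparison_shortExact hX hS (isFiniteLocallyFree_of_isVectorBundle h₁)
    (isFiniteLocallyFree_of_isVectorBundle h₃) hF₁ hF₂ hF₃ E₁ E₂ E₃ α₁ α₂ α₃ hadd₁ hsmul₁ hres₁ hcont₁ hframe₁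
    hadd₂ hsmul₂ hres₂ hcont₂ hframe₂ hadd₃ hsmul₃ hres₃ hcont₃ hframe₃ k

end Summit.HodgeConjecture.HodgeConjecture.Theorems

end
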